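import Mathlib
import HarnessLib
import Summits.Langlands.Langlands.Theses.SkinnerWilesDefectOne
import Literature.NumberTheory.GaloisRepresentations.OrdinaryGaloisRep
import Literature.NumberTheory.Automorphic.CompletedCohomologyHeckeAlgebraGLn

/-!
# Sketch — crux-ideate stmt-Langlands-12920 (EisensteinProModularSeed), ideator 1, round 1

First checkable statements of the two idea cards (`three-five-cousin`, `ribet-dichotomy-hc1`).
Nothing here is a skeleton; `sorry` marks statements only.
-/

namespace Summit.Langlands.Langlands.Cruxes.EisensteinProModularSeed.SketchIdeator1

open Literature Literature.NumberTheory.GaloisRepresentations IsDedekindDomain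

/-- **Orientation from a unit-root congruence** (first lemma of card `three-five-cousin`, also
used by `ribet-dichotomy-hc1`).  Let `r : Γ_K → GL₂(ℚ̄_p)` have an integral model `r₀` upper
triangular mod `𝔪`, let `v` be a place with `r₀` p-distinguished at `v`, and let `Q` be ANY frame
making `r|_{D_v}` upper triangular (an ordinary/Borel refinement).  If the quotient character
`θ₂ = (Q⁻¹ r Q)₁₁` is congruent mod `𝔪` to the residual SUB entry `(r₀)₀₀` on `D_v`
("the unit root reduces to `χ̄_a`", i.e. `U_v ≡ χ_a(ϖ_v)`), then the frame is automatically
ORIENTED in the sense of the crux: `‖Q₀₀‖ ≤ ‖Q₁₀‖`.  Proof sketch: otherwise scale the first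
column of `Q` to `(1, m)` with `m ∈ 𝔪`; the eigen-equation `r₀(σ)(1,m)ᵗ = θ₁(σ)(1,m)ᵗ` gives
`θ₁ ≡ (r₀σ)₀₀`, and `θ₁θ₂ = det ≡ (r₀σ)₀₀ (r₀σ)₁₁` forces `(r₀σ)₀₀ ≡ (r₀σ)₁₁` on `D_v`,
contradicting p-distinguishedness. -/
theorem oriented_of_unitRoot_congr
    {K : Type} [Field K] [NumberField K] (p : ℕ) [Fact p.Prime]
    (O : ValuationSubring (PadicAlgCl p))
    (hO : O = (Valued.v : Valuation (PadicAlgCl p) NNReal).valuationSubring)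
    (r : FramedGaloisRep K (PadicAlgCl p) 2)
    (r₀ : Field.absoluteGaloisGroup K →* Matrix.GeneralLinearGroup (Fin 2) O)
    (hmodel : r.HasUpperTriangularIntegralModel r₀)
    (v : HeightOneSpectrum (NumberField.RingOfIntegers K))
    (hdist : IsPDistinguishedAt r₀ v)
    (Q : Matrix.GeneralLinearGroup (Fin 2) (PadicAlgCl p))
    (hupper : ∀ σ, (Q⁻¹ * r.toLocal v σ * Q).val 1 0 = 0)
    (hunit : ∀ σ : Field.absoluteGaloisGroup (v.adicCompletion K),
        Valued.v ((Q⁻¹ * r.toLocal v σ * Q).val 1 1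
          - ((r₀ (absGaloisRestrict K (v.adicCompletion K) σ)).val 0 0 : PadicAlgCl p)) < 1) :
    Valued.v (Q.val 0 0) ≤ Valued.v (Q.val 1 0) := by
  sorry

/-- **Straightness is exactly the unit-root congruence** (converse direction, for the record):
an oriented frame forces `θ₂ ≡ (r₀)₀₀` and `θ₁ ≡ (r₀)₁₁` on `D_v`. -/
theorem unitRoot_congr_of_oriented
    {K : Type} [Field K] [NumberField K] (p : ℕ) [Fact p.Prime]
    (O : ValuationSubring (PadicAlgCl p))
    (hO : O = (Valued.v : Valuation (PadicAlgCl p) NNReal).valuationSubring)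
    (r : FramedGaloisRep K (PadicAlgCl p) 2)
    (r₀ : Field.absoluteGaloisGroup K →* Matrix.GeneralLinearGroup (Fin 2) O)
    (hmodel : r.HasUpperTriangularIntegralModel r₀)
    (v : HeightOneSpectrum (NumberField.RingOfIntegers K))
    (Q : Matrix.GeneralLinearGroup (Fin 2) (PadicAlgCl p))
    (hQ : Valued.v (Q.val 0 0) ≤ Valued.v (Q.val 1 0))
    (hupper : ∀ σ, (Q⁻¹ * r.toLocal v σ * Q).val 1 0 = 0) :
    ∀ σ : Field.absoluteGaloisGroup (v.adicCompletion K),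
        Valued.v ((Q⁻¹ * r.toLocal v σ * Q).val 1 1
          - ((r₀ (absGaloisRestrict K (v.adicCompletion K) σ)).val 0 0 : PadicAlgCl p)) < 1 := by
  sorry

/-- **Torsion-freeness hinge** (first lemma of card `ribet-dichotomy-hc1`): degree-one cohomology
of the arithmetic quotient `X_U` of `GL₂/K` with `ℤ_p`-coefficients (the tree's
`BigHeckeGLn.levelCohomology U ℤ_[p] 1 = H¹(GL₂(K), Fun(GL₂(𝔸_K^∞)/U, ℤ_p)) = ∏_j H¹(Γ_j, ℤ_p)`)
has no `p`-torsion: `H¹(Γ, ℤ_p) = Hom(Γ, ℤ_p)`.  (The card uses the same fact for the compactly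
supported variant `H¹_c`, which the tree does not have yet.) -/
theorem levelCohomology_one_torsionFree
    {K : Type} [Field K] [NumberField K] (p : ℕ) [Fact p.Prime]
    (U : Subgroup (Literature.NumberTheory.Automorphic.BigHeckeGLn.FiniteAdelicGL 2 K))
    (x : Literature.NumberTheory.Automorphic.BigHeckeGLn.levelCohomology U ℤ_[p] 1)
    (hx : (p : ℤ_[p]) • x = 0) : x = 0 := by
  sorry

/-- **Sign lemma** (card `ribet-dichotomy-hc1`, the Chebotarev input in finite-group form): for
characters `ψ` ("`ϑ̄ω⁻¹`") and `ω` of a finite commutative group, a "non-degenerate level-raising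
class" (`ψ g = 1` but `ω g` of order `> 2`) exists iff `ω²` is not trivial on `ker ψ`. -/
theorem exists_nondegenerate_class_iff {G M : Type} [CommGroup G] [Fintype G] [CommGroup M]
    (ψ ω : G →* M) :
    (∃ g : G, ψ g = 1 ∧ ω g ^ 2 ≠ 1) ↔ ¬ (ψ.ker ≤ (ω * ω).ker) := by
  constructor
  · rintro ⟨g, hψ, hω⟩ hle
    exact hω (by simpa [pow_two, MonoidHom.mem_ker] using hle (show g ∈ ψ.ker from hψ))
  · intro h
    by_contra hne
    apply h
    intro g hg
    rw [MonoidHom.mem_ker, MonoidHom.mul_apply, ← pow_two]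
    by_contra hω
    exact hne ⟨g, hg, hω⟩

end Summit.Langlands.Langlands.Cruxes.EisensteinProModularSeed.SketchIdeator1
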